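import Literature.Analysis.FluidPDE.SawtoothCascade

/-!
# K2 lane (route-2 `SawtoothPulseCascade`, crux dir `K1LocalisedCascade`): the sheet energy of the explicit propagator, EXPANDED

Helper file of the K2 lane (S2 of planner p4's line `bellman-weight`; ACL item stmt-AnomalousDissipation-19491). By `sheet_solution_eq`
(`…KHSheetPropagator`) every solution of the kink-sheet block on `[0, γ]` is `C θ • v + Sn θ • X v`; here the Gram energy
`khForm = m(|w₀|² + |w₁|²) − 2 Re(w̄₀ S w₁)` (`m = −Σ₀`) of such a vector is expanded EXACTLY (`khForm_propagator_expand`):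

  `khForm(C v + Sn X v) = C²·khForm v + C·Sn·2πk·Im(S v̄₀ v₁) + Sn²·k²·(A (|v₀|²+|v₁|²) + 2E·Re(S v̄₀ v₁))`,
  `A = m p² + 4|S|²(p + m)`, `E = p² + 4 m p + 4|S|²`, `p = π/2 − 2m`

(cross term = the energy identity `khBlock_energy_identity`; last term = `‖Xv‖²_M = k² vᴴBᴴMBv`). So the S2 constants
(`KHSheetAbsolute γ B`: `khForm(q θ) ≤ B² khForm(q 0)`) are suprema of an explicit 2×2 Hermitian pencil `[[a, wS],[w̄S̄, a]]` vs `[[m,−S],[−S̄,m]]`,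
`a = C²m + Sn²k²A`, `w = Sn²k²E − C² − iπk C Sn`, over `(k, β, θ)` — in particular `khForm(q θ) ≤ 2τ·khForm(q 0)` with
`τ = C² + Sn²k²W`, `W = ½[(A+E|S|)/(m−|S|) + (A−E|S|)/(m+|S|)]` (trace of the pencil; memo `Cruxes/K1LocalisedCascade/K2SheetBlockPropagator.md`).
No definitions; no statement about the crux. [cite: Drazin2002, §8.3 (8.36)–(8.38) (Rayleigh jump conditions at the kinks of a broken-line profile)] [problem: turb]
-/

-- `Summit.<Summit>.<Problem>`: single-conjunct summit, the duplicate namespace segment is deliberate.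
set_option linter.dupNamespace false

noncomputable section

namespace Summit.AnomalousDissipation.AnomalousDissipation.Theorems.SawtoothPulseCascade.K2PhaseBudget

open Set Real Complex Literature.Analysis.FluidPDE.SawtoothCascade

/-- **Energy of the propagated sheet pair, expanded.** With `m = −Σ₀(k,β)`, `S = S_β(k)`, `p = π/2 + 2Σ₀ = π/2 − 2m`, real `C, Sn` and
`w = C v + Sn X v`, `X v = ik(−p v₀ − 2S v₁, 2S̄ v₀ + p v₁)`:
`m(|w₀|²+|w₁|²) − 2Re(w̄₀ S w₁) = C²(m(|v₀|²+|v₁|²) − 2Re(v̄₀ S v₁)) + C Sn·2πk·Im(S v̄₀ v₁) + Sn² k² (A(|v₀|²+|v₁|²) + 2E Re(S v̄₀ v₁))`,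
`A = m p² + 4|S|²(p+m)`, `E = p² + 4mp + 4|S|²`. [cite: Drazin2002, §8.3 (8.36)–(8.38)] -/
theorem khForm_propagator_expand (k β : ℝ) {p S : ℂ} {m : ℝ} (hp : p = ((π / 2 + 2 * sawSigma0 k β : ℝ) : ℂ))
    (hm : m = -sawSigma0 k β) (C Sn : ℝ) (v₀ v₁ : ℂ) :
    m * (Complex.normSq ((C : ℂ) * v₀ + (Sn : ℂ) * (I * k * (-p * v₀ - 2 * S * v₁))) +
          Complex.normSq ((C : ℂ) * v₁ + (Sn : ℂ) * (I * k * (2 * (starRingEnd ℂ) S * v₀ + p * v₁)))) -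
        2 * ((starRingEnd ℂ) ((C : ℂ) * v₀ + (Sn : ℂ) * (I * k * (-p * v₀ - 2 * S * v₁))) * S *
          ((C : ℂ) * v₁ + (Sn : ℂ) * (I * k * (2 * (starRingEnd ℂ) S * v₀ + p * v₁)))).re =
      C ^ 2 * (m * (Complex.normSq v₀ + Complex.normSq v₁) - 2 * ((starRingEnd ℂ) v₀ * S * v₁).re) +
        C * Sn * (2 * π * k) * (S * (starRingEnd ℂ) v₀ * v₁).im +
        Sn ^ 2 * k ^ 2 * ((m * (π / 2 - 2 * m) ^ 2 + 4 * Complex.normSq S * ((π / 2 - 2 * m) + m)) *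
            (Complex.normSq v₀ + Complex.normSq v₁) +
          2 * ((π / 2 - 2 * m) ^ 2 + 4 * m * (π / 2 - 2 * m) + 4 * Complex.normSq S) * (S * (starRingEnd ℂ) v₀ * v₁).re) := by
  have hp' : p = ((π / 2 - 2 * m : ℝ) : ℂ) := by rw [hp, hm]; push_cast; ring
  rw [hp']
  have e1 : ∀ z : ℂ, ((starRingEnd ℂ) z).re = z.re := fun z => Complex.conj_re z
  have e2 : ∀ z : ℂ, ((starRingEnd ℂ) z).im = -z.im := fun z => Complex.conj_im z
  simp only [Complex.normSq_apply, Complex.mul_re, Complex.mul_im, Complex.add_re, Complex.add_im, Complex.sub_re,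
    Complex.sub_im, Complex.neg_re, Complex.neg_im, Complex.ofReal_re, Complex.ofReal_im, Complex.I_re, Complex.I_im,
    e1, e2, Complex.re_ofNat, Complex.im_ofNat]
  ring

end Summit.AnomalousDissipation.AnomalousDissipation.Theorems.SawtoothPulseCascade.K2PhaseBudget

end
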